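import Mathlib
import HarnessLib
import Summits.CriticalPhenomena.Ising3DConformalLimit.Theses.ArmDressing
import Summits.CriticalPhenomena.Ising3DConformalLimit.Theorems.ArmDressingBallConnectivityMoebiusLatticeTranslation
import Summits.CriticalPhenomena.Ising3DConformalLimit.Theorems.ArmDressingBallConnectivityMoebiusTranslationInvariance
import Literature.Probability.LatticeModels.RandomClusterPointGroupInvariance

/-!
# Crux `ArmDressing.BallConnectivityMoebius` (stmt-CriticalPhenomena-16131) — line `registered` (born `Lines/birth.lean`)

Skeleton registrar `planner-skel-stmt-CriticalPhenomena-16131-0`, 2026-08-17 (BC3 of the Lean birth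
certificate; route `route-CriticalPhenomena-ArmDressing`, re-audit bin REPAIRABLE).  The crux is
FIXED: its decl and signature are the route's (`Theses/ArmDressing.lean`, item 16131, rank 2,
"THE CLE RESIDUE"); `BallConnectivityMoebius_of` below concludes it BY NAME.

RESHAPE r1 (lead `prover-line-stmt-CriticalPhenomena-16131-0`, 2026-08-17, cycle 1): the planner's
stub 2 `stub_euclideanInvariance` ((T) ∧ (O) from one hypothesis set) is split along the line
provable ∣ open into THREE registered stubs with the same composition —
`stub_latticeTranslation` (2a, the thermodynamic-limit statement: `Pr` is invariant under lattice
translations of finite / co-finite probe families; provable from the tree's wired domain-Markov /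
FKG / iso-invariance API and `m*(β_c(3)) = 0`), `stub_translationInvariance` (2b: 2a ⇒ (T) for any
continuous full-filter limit family, by density of `⋃_δ δℤ³` and continuity; provable) and
`stub_rotationInvariance` (2c: (O), isotropy — open; its hyperoctahedral part is exact and lands as
a helper).  Stubs 1 and 3 are untouched.  5 stubs ≤ stubs_max = 7; `BallConnectivityMoebius_of`
takes the five `Registered.*` aliases and is sorry-free.

## The crux

For every `m` and every set `R` of relations on `m` indices, the thermodynamic-limit probability
`Pr` (wired critical FK-Ising boxes `Λ_L ↑ ℤ³`, `q = 2`, `p = 1 - exp(-2 β_c(3))`) that the open-path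
connection relation among the mesh-`δ` discretisations of `m` GENERALISED BALLS (data `(cᵢ, rᵢ)`:
`rᵢ > 0` the closed ball, `rᵢ < 0` the closed exterior) lies in `R` converges as `δ → 0⁺` to
`lam (data)`, with `lam` continuous on `{∀ i, rᵢ ≠ 0}` and INVARIANT under (T) translations,
(D) dilations, (O) linear isometries and (I) the unit inversion `(c, r) ↦ (c, r)/(‖c‖² - r²)`.

## The cut (existence ∣ Euclidean motions ∣ inversion) — the standard symmetry ladder of a
## scaling limit, with the one EXACT lattice symmetry (dilation = change of mesh) paid in the glue

* `stub_ballLawsExist` (OPEN, XL — compactness + uniqueness of the full-filter limit; the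
  planner's foreseen child `BallLawsExist` minus its similarity clause): for every `m, R` the
  ball-connection probabilities converge as `δ → 0⁺` to a limit `lam` continuous on all
  nonzero-radius configurations (tangent / nested / overlapping included, as the crux demands).
  Strictly weaker than the crux: no invariance at all is claimed.
* (r1) `stub_latticeTranslation` (PROVABLE-SCALE, L): for every finite family `K` of lattice
  probe sets, each finite or co-finite, every lattice vector `z` and every `R`,
  `Pr m (fun i => {x | x - z ∈ K i}) R = Pr m K R` — automorphism (translation) invariance of the
  wired thermodynamic limit at `p_c(2)` on `ℤ³` (Grimmett 2006 Thm 4.19(b) pattern; the limit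
  exists: ghost-wired up-set events are eventually antitone in the box, the ghost correction is
  `≤ Σ φ¹_{Λ_L}(x ↔ ∂Λ_L) → m*(β_c(3)) = 0`, general `R` by Möbius inversion; shifted boxes are
  sandwiched between centred boxes).
* (r1) `stub_translationInvariance` (PROVABLE, S/M): `stub_latticeTranslation` ⇒ (T) for ANY
  continuous full-filter limit family `lam m R`: `lam (p + mesh δ z) = lam p` from the exact identity
  `disc (δ/n) (gball (c + mesh δ z, r)) = {x | x - n • z ∈ disc (δ/n) (gball (c, r))}` along
  `δ/n → 0⁺` (uniqueness of limits), then density of such vectors and continuity of `lam m R`.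
* (r1) `stub_rotationInvariance` (OPEN — isotropy): (O) for any continuous full-filter limit family.
  Genuinely open in `d = 3` (no Smirnov-type embedding argument; planar FK rotation invariance,
  Duminil-Copin–Kozlowski–Krachun–Manolescu–Oulamara 2020, is two-dimensional); the hyperoctahedral
  subgroup (signed coordinate permutations) is exact at finite volume and lands as a helper.
* `stub_inversionInvariance` (OPEN, open-problem — LOAD-BEARING, the conformal generator; the
  planner's foreseen child `BallLawsInversion`): any continuous, translation-, dilation- and
  `O(3)`-invariant full-filter limit family is invariant under the unit inversion acting on
  generalised-ball data by `ginv (c, r) = ((‖c‖² - r²)⁻¹ • c, r/(‖c‖² - r²))` on configurations with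
  `‖cᵢ‖ ≠ |rᵢ|` (no sphere through the origin) — the 3D Cardy–Smirnov statement proper.

`BallConnectivityMoebius_of` (hypotheses = the name-keyed aliases `Registered.stub_*`, verbatim the
five stub statements) is a genuine assembly (no sorry): it CHOOSES the limit family from stub 1,
PROVES clause (D) — dilation invariance — from the exact lattice identity
`disc δ (gball (κ • c, κ r)) = disc (δ/κ) (gball (c, r))` (a dilation of the data is a change of
mesh, `δ ↦ δ/κ` maps `𝓝[>] 0` to itself, limits along `𝓝[>] 0` are unique), gets (T) as
`stub 2b (stub 2a)`, (O) from stub 2c, feeds (T),(D),(O) into stub 3 for (I), and reassembles the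
six clauses of the crux for each `m, R`.  The crux's `let`-vocabulary is mirrored by the local definitions `bmesh/bdisc/bgball/bPr`
(definitionally equal to the `let` values; the conversions in the proof are `rfl`-transport).

Disproof used: none exists for this crux (`ledger crux ls stmt-CriticalPhenomena-16131`: no
workfiles before this one; no `Theorems/…/Negative/`).  Negatives index (11 CriticalPhenomena
entries, none in this sub-problem): no stub restates a refuted statement.
BC3 probes (registrar's folder `bc/probe_<stub>.lean`): for each stub, `stub → BallConnectivityMoebius`
and `stub → Ising3DConformalLimit` by `exact?` / `simpa using h` / `simpa [target] using h` / `aesop`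
(and the combined `first | …`) all FAIL — see `Lines/birth.md`.
-/

set_option maxHeartbeats 1000000

namespace Summit.CriticalPhenomena.Ising3DConformalLimit.Cruxes.BallConnectivityMoebius.Birth

open scoped BigOperators Topology Manifold Classical MeasureTheory ProbabilityTheory Matrix InnerProductSpace ComplexConjugate ContinuousMap
open Filter Set Function TopologicalSpace MeasureTheory


/-- stub 1 (OPEN, XL; strictly weaker than the crux — no invariance claimed): **the ball-connection
laws exist** — for every `m` and every relation set `R`, the thermodynamic-limit critical FK-Ising
probability that the connection relation among the mesh-`δ` discretisations of `m` generalised balls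
lies in `R` converges as `δ → 0⁺`, to a limit continuous on all nonzero-radius configurations.
(Compactness is free along subsequences; the content is UNIQUENESS of the full-filter limit and
continuity at tangencies — Camia2023 §2 / CamiaFeng2025 Lemma 12 pattern in the plane, open in
`d = 3`.) -/
theorem stub_ballLawsExist : open Literature.Probability.LatticeModels Literature.Probability.Percolation Literature.Barriers.CriticalPhenomena Filter Topology in let E3 := EuclideanSpace ℝ (Fin 3); let μ : (L : ℕ) → MeasureTheory.Measure (BondConfig (BoxV 3 L)) := fun L => rcMeasure (boxGraph 3 L) (fkIsingParam (criticalBeta 3)) 2 (boxBoundary 3 L); let PrL : (m : ℕ) → (Fin m → Set (Site 3)) → Set (Fin m → Fin m → Prop) → ℕ → ℝ := fun _ K R L => (μ L).real {ω | (fun i j => ∃ x y : BoxV 3 L, x.1 ∈ K i ∧ y.1 ∈ K j ∧ (openGraph ω).Reachable x y) ∈ R}; let Pr : (m : ℕ) → (Fin m → Set (Site 3)) → Set (Fin m → Fin m → Prop) → ℝ := fun m K R => limUnder atTop (PrL m K R); let mesh : ℝ → Site 3 → E3 := fun δ z => WithLp.toLp 2 fun i : Fin 3 => δ * (z i : ℝ);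 let disc : ℝ → Set E3 → Set (Site 3) := fun δ A => {x | mesh δ x ∈ A}; let gball : E3 × ℝ → Set E3 := fun p => if 0 < p.2 then Metric.closedBall p.1 p.2 else (Metric.ball p.1 (-p.2))ᶜ; let ginv : E3 × ℝ → E3 × ℝ := fun p => ((‖p.1‖ ^ 2 - p.2 ^ 2)⁻¹ • p.1, p.2 / (‖p.1‖ ^ 2 - p.2 ^ 2)); ∀ (m : ℕ) (R : Set (Fin m → Fin m → Prop)), ∃ lam : (Fin m → E3 × ℝ) → ℝ, ContinuousOn lam {p | ∀ i, (p i).2 ≠ 0} ∧ (∀ p : Fin m → E3 × ℝ, (∀ i, (p i).2 ≠ 0) → Tendsto (fun δ => Pr m (fun i => disc δ (gball (p i))) R) (𝓝[>] 0) (𝓝 (lam p))) := by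
  sorry


set_option linter.unusedVariables false in -- the crux preamble's `disc/gball/ginv` are unused in 2a
/-- stub 2a (CLOSED — landed p148066 `…ArmDressingBallConnectivityMoebiusLatticeTranslation.lean`, with Literature
infrastructure p147436 `RandomClusterGhostConnection`, p147468 `CriticalFKIsingArmVanishes`, p147834
`CriticalFKIsingConnectionLaws`; thermodynamic-limit API): **lattice translation invariance of the
connection laws** — for every finite family of lattice probe sets each of which is finite or
co-finite (the mesh-`δ` discretisations of closed balls, resp. closed exteriors, are such), the
thermodynamic-limit probability `Pr` that the connection relation lies in `R` is unchanged when
every probe is translated by the same lattice vector `z`.  Content: the `L → ∞` limit of the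
wired-box probabilities EXISTS for such families (ghost-wired up-set connection events are
eventually antitone in the box by the wired domain Markov property + positive association,
`rcMeasure_real_box_restrict_le`; the ghost correction vanishes because
`φ¹_{Λ_L}(x ↔ ∂Λ_L) → m*(β_c(3)) = 0`, `thetaWiredBox_succ_eq_isingCorr_plus` +
`spontaneousMagnetization_criticalBeta_eq_zero_holds`; general `R` by Möbius inversion over the
finite lattice of relations) and shifted boxes are sandwiched between centred ones
(`rcMeasure_real_preimage_relabel` with `zdShiftIso`). Grimmett 2006 Thm 4.19(b)/(c) pattern for the
wired measure at `p_c(2)` on `ℤ³`. -/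
theorem stub_latticeTranslation : open Literature.Probability.LatticeModels Literature.Probability.Percolation Literature.Barriers.CriticalPhenomena Filter Topology in let E3 := EuclideanSpace ℝ (Fin 3); let μ : (L : ℕ) → MeasureTheory.Measure (BondConfig (BoxV 3 L)) := fun L => rcMeasure (boxGraph 3 L) (fkIsingParam (criticalBeta 3)) 2 (boxBoundary 3 L); let PrL : (m : ℕ) → (Fin m → Set (Site 3)) → Set (Fin m → Fin m → Prop) → ℕ → ℝ := fun _ K R L => (μ L).real {ω | (fun i j => ∃ x y : BoxV 3 L, x.1 ∈ K i ∧ y.1 ∈ K j ∧ (openGraph ω).Reachable x y) ∈ R}; let Pr : (m : ℕ) → (Fin m → Set (Site 3)) → Set (Fin m → Fin m → Prop) → ℝ := fun m K R => limUnder atTop (PrL m K R); let mesh : ℝ → Site 3 → E3 := fun δ z => WithLp.toLp 2 fun i : Fin 3 => δ * (z i : ℝ); let disc : ℝ → Set E3 → Set (Site 3) := fun δ A => {x | mesh δ x ∈ A}; let gball : E3 × ℝ → Set E3 := fun p => if 0 < p.2 then Metric.closedBall p.1 p.2 else (Metric.ball p.1 (-p.2))ᶜ; let ginv : E3 × ℝ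 → E3 × ℝ := fun p => ((‖p.1‖ ^ 2 - p.2 ^ 2)⁻¹ • p.1, p.2 / (‖p.1‖ ^ 2 - p.2 ^ 2)); (∀ (m : ℕ) (R : Set (Fin m → Fin m → Prop)) (K : Fin m → Set (Site 3)) (z : Site 3), (∀ i, (K i).Finite ∨ (K i)ᶜ.Finite) → Pr m (fun i => {x | x - z ∈ K i}) R = Pr m K R) := by
  exact Summit.CriticalPhenomena.Ising3DConformalLimit.ArmDressingBallConnectivityMoebius.stub_latticeTranslation


set_option linter.unusedVariables false in -- the crux preamble's `ginv` is unused in 2b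
/-- stub 2b (CLOSED — landed p149471 `…ArmDressingBallConnectivityMoebiusTranslationInvariance.lean`; pure limit
bookkeeping): **continuum translation invariance from lattice
translation invariance** — given stub 2a, any continuous full-filter limit family `lam m R` is
invariant under every translation `u ∈ ℝ³`: for `u = mesh δ z` use the exact identity
`disc (δ/n) (gball (c + mesh δ z, r)) = {x | x - n • z ∈ disc (δ/n) (gball (c, r))}` along
`δ/n → 0⁺` and uniqueness of limits; such `u` are dense and `lam m R` is continuous. -/
theorem stub_translationInvariance : open Literature.Probability.LatticeModels Literature.Probability.Percolation Literature.Barriers.CriticalPhenomena Filter Topology in let E3 := EuclideanSpace ℝ (Fin 3); let μ : (L : ℕ) → MeasureTheory.Measure (BondConfig (BoxV 3 L)) := fun L => rcMeasure (boxGraph 3 L) (fkIsingParam (criticalBeta 3)) 2 (boxBoundary 3 L); let PrL : (m : ℕ) → (Fin m → Set (Site 3)) → Set (Fin m → Fin m → Prop) → ℕ → ℝ := fun _ K R L => (μ L).real {ω | (fun i j => ∃ x y : BoxV 3 L, x.1 ∈ K i ∧ y.1 ∈ K j ∧ (openGraph ω).Reachable x y) ∈ R}; let Pr : (m : ℕ)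 → (Fin m → Set (Site 3)) → Set (Fin m → Fin m → Prop) → ℝ := fun m K R => limUnder atTop (PrL m K R); let mesh : ℝ → Site 3 → E3 := fun δ z => WithLp.toLp 2 fun i : Fin 3 => δ * (z i : ℝ); let disc : ℝ → Set E3 → Set (Site 3) := fun δ A => {x | mesh δ x ∈ A}; let gball : E3 × ℝ → Set E3 := fun p => if 0 < p.2 then Metric.closedBall p.1 p.2 else (Metric.ball p.1 (-p.2))ᶜ; let ginv : E3 × ℝ → E3 × ℝ := fun p => ((‖p.1‖ ^ 2 - p.2 ^ 2)⁻¹ • p.1, p.2 / (‖p.1‖ ^ 2 - p.2 ^ 2)); (∀ (m : ℕ) (R : Set (Fin m → Fin m → Prop)) (K : Fin m → Set (Site 3)) (z : Site 3), (∀ i, (K i).Finite ∨ (K i)ᶜ.Finite) → Pr m (fun i => {x | x - z ∈ K i}) R = Pr m K R) → ∀ lam : (m : ℕ) → Set (Fin m → Fin m → Prop) → (Fin m → E3 × ℝ) → ℝ, (∀ (m : ℕ) (R : Set (Fin m → Fin m → Prop)), ContinuousOn (lam m R) {p | ∀ i, (p i).2 ≠ 0}) → (∀ (m : ℕ) (R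 : Set (Fin m → Fin m → Prop)) (p : Fin m → E3 × ℝ), (∀ i, (p i).2 ≠ 0) → Tendsto (fun δ => Pr m (fun i => disc δ (gball (p i))) R) (𝓝[>] 0) (𝓝 (lam m R p))) → (∀ (m : ℕ) (R : Set (Fin m → Fin m → Prop)) (p : Fin m → E3 × ℝ) (u : E3), (∀ i, (p i).2 ≠ 0) → lam m R (fun i => ((p i).1 + u, (p i).2)) = lam m R p) := by
  exact Summit.CriticalPhenomena.Ising3DConformalLimit.ArmDressingBallConnectivityMoebius.stub_translationInvariance


/-- stub 2c (OPEN — isotropy): **rotation invariance** — any continuous full-filter limit family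
`lam m R` is invariant under every linear isometry `A : E3 ≃ₗᵢ[ℝ] E3`.  The hyperoctahedral part
(signed coordinate permutations, the point group of `ℤ³`) is exact at finite volume
(`rcMeasure_real_preimage_relabel` with `finsetGraphIso (zdSignedPermIso π ε)` on the invariant box)
and provable; a general `A` is the isotropy of critical 3D FK-Ising connectivities — open
(planar analogue: Duminil-Copin–Kozlowski–Krachun–Manolescu–Oulamara 2020). -/
theorem stub_rotationInvariance : open Literature.Probability.LatticeModels Literature.Probability.Percolation Literature.Barriers.CriticalPhenomena Filter Topology in let E3 := EuclideanSpace ℝ (Fin 3); let μ : (L : ℕ) → MeasureTheory.Measure (BondConfig (BoxV 3 L)) := fun L => rcMeasure (boxGraph 3 L) (fkIsingParam (criticalBeta 3)) 2 (boxBoundary 3 L); let PrL : (m : ℕ) → (Fin m → Set (Site 3)) → Set (Fin m → Fin m → Prop) → ℕ → ℝ := fun _ K R L => (μ L).real {ω | (fun i j => ∃ x y : BoxV 3 L, x.1 ∈ K i ∧ y.1 ∈ K j ∧ (openGraph ω).Reachable x y) ∈ R}; let Pr : (m : ℕ) → (Fin m → Set (Site 3)) → Set (Fin m → Fin m → Prop)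 → ℝ := fun m K R => limUnder atTop (PrL m K R); let mesh : ℝ → Site 3 → E3 := fun δ z => WithLp.toLp 2 fun i : Fin 3 => δ * (z i : ℝ); let disc : ℝ → Set E3 → Set (Site 3) := fun δ A => {x | mesh δ x ∈ A}; let gball : E3 × ℝ → Set E3 := fun p => if 0 < p.2 then Metric.closedBall p.1 p.2 else (Metric.ball p.1 (-p.2))ᶜ; let ginv : E3 × ℝ → E3 × ℝ := fun p => ((‖p.1‖ ^ 2 - p.2 ^ 2)⁻¹ • p.1, p.2 / (‖p.1‖ ^ 2 - p.2 ^ 2)); ∀ lam : (m : ℕ) → Set (Fin m → Fin m → Prop) → (Fin m → E3 × ℝ) → ℝ, (∀ (m : ℕ) (R : Set (Fin m → Fin m → Prop)), ContinuousOn (lam m R) {p | ∀ i, (p i).2 ≠ 0}) → (∀ (m : ℕ) (R : Set (Fin m → Fin m → Prop)) (p : Fin m → E3 × ℝ), (∀ i, (p i).2 ≠ 0) → Tendsto (fun δ => Pr m (fun i => disc δ (gball (p i))) R) (𝓝[>] 0) (𝓝 (lam m R p))) → (∀ (m : ℕ) (R : Set (Fin m → Fin m → Prop)) (p : Fin m →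 E3 × ℝ) (A : E3 ≃ₗᵢ[ℝ] E3), (∀ i, (p i).2 ≠ 0) → lam m R (fun i => (A (p i).1, (p i).2)) = lam m R p) := by
  sorry


/-- stub 3 (OPEN, open-problem; LOAD-BEARING — the conformal generator, the planner's foreseen child
`BallLawsInversion`): **inversion invariance** — any continuous, translation-, dilation- and
`O(3)`-invariant full-filter limit family of the ball-connection probabilities is invariant under
the unit inversion acting on generalised-ball data, `(c, r) ↦ ((‖c‖² - r²)⁻¹ • c, r/(‖c‖² - r²))`,
on configurations none of whose spheres passes through the origin. -/
theorem stub_inversionInvariance : open Literature.Probability.LatticeModels Literature.Probability.Percolation Literature.Barriers.CriticalPhenomena Filter Topology in let E3 := EuclideanSpace ℝ (Fin 3); let μ : (L : ℕ) → MeasureTheory.Measure (BondConfig (BoxV 3 L)) := fun L => rcMeasure (boxGraph 3 L) (fkIsingParam (criticalBeta 3)) 2 (boxBoundary 3 L); let PrL : (m : ℕ) → (Fin m → Set (Site 3)) → Set (Fin m → Fin m → Prop) → ℕ → ℝ := fun _ K R L => (μ L).real {ω | (fun i j => ∃ x y : BoxV 3 L, x.1 ∈ K i ∧ y.1 ∈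 K j ∧ (openGraph ω).Reachable x y) ∈ R}; let Pr : (m : ℕ) → (Fin m → Set (Site 3)) → Set (Fin m → Fin m → Prop) → ℝ := fun m K R => limUnder atTop (PrL m K R); let mesh : ℝ → Site 3 → E3 := fun δ z => WithLp.toLp 2 fun i : Fin 3 => δ * (z i : ℝ); let disc : ℝ → Set E3 → Set (Site 3) := fun δ A => {x | mesh δ x ∈ A}; let gball : E3 × ℝ → Set E3 := fun p => if 0 < p.2 then Metric.closedBall p.1 p.2 else (Metric.ball p.1 (-p.2))ᶜ; let ginv : E3 × ℝ → E3 × ℝ := fun p => ((‖p.1‖ ^ 2 - p.2 ^ 2)⁻¹ • p.1, p.2 / (‖p.1‖ ^ 2 - p.2 ^ 2)); ∀ lam : (m : ℕ) → Set (Fin m → Fin m → Prop) → (Fin m → E3 × ℝ) → ℝ, (∀ (m : ℕ) (R : Set (Fin m → Fin m → Prop)), ContinuousOn (lam m R) {p | ∀ i, (p i).2 ≠ 0}) → (∀ (m : ℕ) (R : Set (Fin m → Fin m → Prop)) (p : Fin m → E3 × ℝ), (∀ i, (p i).2 ≠ 0) → Tendsto (fun δ => Pr m (fun i => disc δ (gball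 (p i))) R) (𝓝[>] 0) (𝓝 (lam m R p))) → (∀ (m : ℕ) (R : Set (Fin m → Fin m → Prop)) (p : Fin m → E3 × ℝ) (u : E3), (∀ i, (p i).2 ≠ 0) → lam m R (fun i => ((p i).1 + u, (p i).2)) = lam m R p) → (∀ (m : ℕ) (R : Set (Fin m → Fin m → Prop)) (p : Fin m → E3 × ℝ) (κ : ℝ), (∀ i, (p i).2 ≠ 0) → 0 < κ → lam m R (fun i => (κ • (p i).1, κ * (p i).2)) = lam m R p) → (∀ (m : ℕ) (R : Set (Fin m → Fin m → Prop)) (p : Fin m → E3 × ℝ) (A : E3 ≃ₗᵢ[ℝ] E3), (∀ i, (p i).2 ≠ 0) → lam m R (fun i => (A (p i).1, (p i).2)) = lam m R p) → (∀ (m : ℕ) (R : Set (Fin m → Fin m → Prop)) (p : Fin m → E3 × ℝ), (∀ i, (p i).2 ≠ 0 ∧ ‖(p i).1‖ ≠ |(p i).2|) → lam m R (fun i => ginv (p i)) = lam m R p) := by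
  sorry


/-! ### Name-keyed aliases of the five stub statements (verbatim the types of the `stub_*` theorems
above; the skeleton audit admits hypotheses of `BallConnectivityMoebius_of` only BY NAME) -/
namespace Registered

set_option linter.unusedVariables false in
/-- Alias of the statement of `stub_ballLawsExist`, keyed by the registered stub name. -/
abbrev stub_ballLawsExist : Prop := open Literature.Probability.LatticeModels Literature.Probability.Percolation Literature.Barriers.CriticalPhenomena Filter Topology in let E3 := EuclideanSpace ℝ (Fin 3); let μ : (L : ℕ) → MeasureTheory.Measure (BondConfig (BoxV 3 L)) := fun L => rcMeasure (boxGraph 3 L) (fkIsingParam (criticalBeta 3)) 2 (boxBoundary 3 L); let PrL : (m : ℕ) → (Fin m → Set (Site 3)) → Set (Fin m → Fin m → Prop) → ℕ → ℝ := fun _ K R L => (μ L).real {ω | (fun i j => ∃ x y : BoxV 3 L, x.1 ∈ K i ∧ y.1 ∈ K j ∧ (openGraph ω).Reachable x y) ∈ R}; let Pr : (m : ℕ) → (Fin m → Set (Site 3)) → Set (Fin m → Fin m → Prop) → ℝ := fun m K R => limUnder atTop (PrL m K R); let mesh : ℝ → Site 3 → E3 := fun δ z => WithLp.toLp 2 fun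 i : Fin 3 => δ * (z i : ℝ); let disc : ℝ → Set E3 → Set (Site 3) := fun δ A => {x | mesh δ x ∈ A}; let gball : E3 × ℝ → Set E3 := fun p => if 0 < p.2 then Metric.closedBall p.1 p.2 else (Metric.ball p.1 (-p.2))ᶜ; let ginv : E3 × ℝ → E3 × ℝ := fun p => ((‖p.1‖ ^ 2 - p.2 ^ 2)⁻¹ • p.1, p.2 / (‖p.1‖ ^ 2 - p.2 ^ 2)); ∀ (m : ℕ) (R : Set (Fin m → Fin m → Prop)), ∃ lam : (Fin m → E3 × ℝ) → ℝ, ContinuousOn lam {p | ∀ i, (p i).2 ≠ 0} ∧ (∀ p : Fin m → E3 × ℝ, (∀ i, (p i).2 ≠ 0) → Tendsto (fun δ => Pr m (fun i => disc δ (gball (p i))) R) (𝓝[>] 0) (𝓝 (lam p)))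

set_option linter.unusedVariables false in
/-- Alias of the statement of `stub_latticeTranslation`, keyed by the registered stub name. -/
abbrev stub_latticeTranslation : Prop := open Literature.Probability.LatticeModels Literature.Probability.Percolation Literature.Barriers.CriticalPhenomena Filter Topology in let E3 := EuclideanSpace ℝ (Fin 3); let μ : (L : ℕ) → MeasureTheory.Measure (BondConfig (BoxV 3 L)) := fun L => rcMeasure (boxGraph 3 L) (fkIsingParam (criticalBeta 3)) 2 (boxBoundary 3 L); let PrL : (m : ℕ) → (Fin m → Set (Site 3)) → Set (Fin m → Fin m → Prop) → ℕ → ℝ := fun _ K R L => (μ L).real {ω | (fun i j => ∃ x y : BoxV 3 L, x.1 ∈ K i ∧ y.1 ∈ K j ∧ (openGraph ω).Reachable x y) ∈ R}; let Pr : (m : ℕ) → (Fin m → Set (Site 3)) → Set (Fin m → Fin m → Prop) → ℝ := fun m K R => limUnder atTop (PrL m K R); let mesh : ℝ → Site 3 → E3 := fun δ z => WithLp.toLp 2 fun i : Fin 3 => δ * (z i : ℝ); let disc : ℝ → Set E3 → Set (Site 3) := fun δ A => {x | mesh δ x ∈ A}; let gball : E3 × ℝ → Set E3 := fun p => if 0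 < p.2 then Metric.closedBall p.1 p.2 else (Metric.ball p.1 (-p.2))ᶜ; let ginv : E3 × ℝ → E3 × ℝ := fun p => ((‖p.1‖ ^ 2 - p.2 ^ 2)⁻¹ • p.1, p.2 / (‖p.1‖ ^ 2 - p.2 ^ 2)); (∀ (m : ℕ) (R : Set (Fin m → Fin m → Prop)) (K : Fin m → Set (Site 3)) (z : Site 3), (∀ i, (K i).Finite ∨ (K i)ᶜ.Finite) → Pr m (fun i => {x | x - z ∈ K i}) R = Pr m K R)

set_option linter.unusedVariables false in
/-- Alias of the statement of `stub_translationInvariance`, keyed by the registered stub name. -/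
abbrev stub_translationInvariance : Prop := open Literature.Probability.LatticeModels Literature.Probability.Percolation Literature.Barriers.CriticalPhenomena Filter Topology in let E3 := EuclideanSpace ℝ (Fin 3); let μ : (L : ℕ) → MeasureTheory.Measure (BondConfig (BoxV 3 L)) := fun L => rcMeasure (boxGraph 3 L) (fkIsingParam (criticalBeta 3)) 2 (boxBoundary 3 L); let PrL : (m : ℕ) → (Fin m → Set (Site 3)) → Set (Fin m → Fin m → Prop) → ℕ → ℝ := fun _ K R L => (μ L).real {ω | (fun i j => ∃ x y : BoxV 3 L, x.1 ∈ K i ∧ y.1 ∈ K j ∧ (openGraph ω).Reachable x y) ∈ R}; let Pr : (m : ℕ) → (Fin m → Set (Site 3)) → Set (Fin m → Fin m → Prop) → ℝ := fun m K R => limUnder atTop (PrL m K R); let mesh : ℝ → Site 3 → E3 := fun δ z => WithLp.toLp 2 fun i : Fin 3 => δ * (z i : ℝ); let disc : ℝ → Set E3 → Set (Site 3) := fun δ A => {x | mesh δ x ∈ A}; let gball : E3 × ℝ → Set E3 := fun p => if 0 < p.2 then Metric.closedBall p.1 p.2 else (Metric.ball p.1 (-p.2))ᶜ; let ginv : E3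 × ℝ → E3 × ℝ := fun p => ((‖p.1‖ ^ 2 - p.2 ^ 2)⁻¹ • p.1, p.2 / (‖p.1‖ ^ 2 - p.2 ^ 2)); (∀ (m : ℕ) (R : Set (Fin m → Fin m → Prop)) (K : Fin m → Set (Site 3)) (z : Site 3), (∀ i, (K i).Finite ∨ (K i)ᶜ.Finite) → Pr m (fun i => {x | x - z ∈ K i}) R = Pr m K R) → ∀ lam : (m : ℕ) → Set (Fin m → Fin m → Prop) → (Fin m → E3 × ℝ) → ℝ, (∀ (m : ℕ) (R : Set (Fin m → Fin m → Prop)), ContinuousOn (lam m R) {p | ∀ i, (p i).2 ≠ 0}) → (∀ (m : ℕ) (R : Set (Fin m → Fin m → Prop)) (p : Fin m → E3 × ℝ), (∀ i, (p i).2 ≠ 0) → Tendsto (fun δ => Pr m (fun i => disc δ (gball (p i))) R) (𝓝[>] 0) (𝓝 (lam m R p))) → (∀ (m : ℕ) (R : Set (Fin m → Fin m → Prop)) (p : Fin m → E3 × ℝ) (u : E3), (∀ i, (p i).2 ≠ 0) → lam m R (fun i => ((p i).1 + u, (p i).2)) = lam m R p)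

set_option linter.unusedVariables false in
/-- Alias of the statement of `stub_rotationInvariance`, keyed by the registered stub name. -/
abbrev stub_rotationInvariance : Prop := open Literature.Probability.LatticeModels Literature.Probability.Percolation Literature.Barriers.CriticalPhenomena Filter Topology in let E3 := EuclideanSpace ℝ (Fin 3); let μ : (L : ℕ) → MeasureTheory.Measure (BondConfig (BoxV 3 L)) := fun L => rcMeasure (boxGraph 3 L) (fkIsingParam (criticalBeta 3)) 2 (boxBoundary 3 L); let PrL : (m : ℕ) → (Fin m → Set (Site 3)) → Set (Fin m → Fin m → Prop) → ℕ → ℝ := fun _ K R L => (μ L).real {ω | (fun i j => ∃ x y : BoxV 3 L, x.1 ∈ K i ∧ y.1 ∈ K j ∧ (openGraph ω).Reachable x y) ∈ R}; let Pr : (m : ℕ) → (Fin m → Set (Site 3)) → Set (Fin m → Fin m → Prop) → ℝ := fun m K R => limUnder atTop (PrL m K R); let mesh : ℝ → Site 3 → E3 := fun δ z => WithLp.toLp 2 fun i : Fin 3 => δ * (z i : ℝ); let disc : ℝ → Set E3 → Set (Site 3) := fun δ A => {x | mesh δ x ∈ A}; let gball : E3 × ℝ → Set E3 := fun p => if 0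 < p.2 then Metric.closedBall p.1 p.2 else (Metric.ball p.1 (-p.2))ᶜ; let ginv : E3 × ℝ → E3 × ℝ := fun p => ((‖p.1‖ ^ 2 - p.2 ^ 2)⁻¹ • p.1, p.2 / (‖p.1‖ ^ 2 - p.2 ^ 2)); ∀ lam : (m : ℕ) → Set (Fin m → Fin m → Prop) → (Fin m → E3 × ℝ) → ℝ, (∀ (m : ℕ) (R : Set (Fin m → Fin m → Prop)), ContinuousOn (lam m R) {p | ∀ i, (p i).2 ≠ 0}) → (∀ (m : ℕ) (R : Set (Fin m → Fin m → Prop)) (p : Fin m → E3 × ℝ), (∀ i, (p i).2 ≠ 0) → Tendsto (fun δ => Pr m (fun i => disc δ (gball (p i))) R) (𝓝[>] 0) (𝓝 (lam m R p))) → (∀ (m : ℕ) (R : Set (Fin m → Fin m → Prop)) (p : Fin m → E3 × ℝ) (A : E3 ≃ₗᵢ[ℝ] E3), (∀ i, (p i).2 ≠ 0) → lam m R (fun i => (A (p i).1, (p i).2)) = lam m R p)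

set_option linter.unusedVariables false in
/-- Alias of the statement of `stub_inversionInvariance`, keyed by the registered stub name. -/
abbrev stub_inversionInvariance : Prop := open Literature.Probability.LatticeModels Literature.Probability.Percolation Literature.Barriers.CriticalPhenomena Filter Topology in let E3 := EuclideanSpace ℝ (Fin 3); let μ : (L : ℕ) → MeasureTheory.Measure (BondConfig (BoxV 3 L)) := fun L => rcMeasure (boxGraph 3 L) (fkIsingParam (criticalBeta 3)) 2 (boxBoundary 3 L); let PrL : (m : ℕ) → (Fin m → Set (Site 3)) → Set (Fin m → Fin m → Prop) → ℕ → ℝ := fun _ K R L => (μ L).real {ω | (fun i j => ∃ x y : BoxV 3 L, x.1 ∈ K i ∧ y.1 ∈ K j ∧ (openGraph ω).Reachable x y) ∈ R}; let Pr : (m : ℕ) → (Fin m → Set (Site 3)) → Set (Fin m → Fin m → Prop) → ℝ := fun m K R => limUnder atTop (PrL m K R); let mesh : ℝ → Site 3 → E3 := fun δ z => WithLp.toLp 2 fun i : Fin 3 => δ * (z i : ℝ); let disc : ℝ → Set E3 → Set (Site 3) := fun δ A => {x | mesh δ x ∈ A}; let gball : E3 × ℝ → Set E3 := fun p => if 0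 < p.2 then Metric.closedBall p.1 p.2 else (Metric.ball p.1 (-p.2))ᶜ; let ginv : E3 × ℝ → E3 × ℝ := fun p => ((‖p.1‖ ^ 2 - p.2 ^ 2)⁻¹ • p.1, p.2 / (‖p.1‖ ^ 2 - p.2 ^ 2)); ∀ lam : (m : ℕ) → Set (Fin m → Fin m → Prop) → (Fin m → E3 × ℝ) → ℝ, (∀ (m : ℕ) (R : Set (Fin m → Fin m → Prop)), ContinuousOn (lam m R) {p | ∀ i, (p i).2 ≠ 0}) → (∀ (m : ℕ) (R : Set (Fin m → Fin m → Prop)) (p : Fin m → E3 × ℝ), (∀ i, (p i).2 ≠ 0) → Tendsto (fun δ => Pr m (fun i => disc δ (gball (p i))) R) (𝓝[>] 0) (𝓝 (lam m R p))) → (∀ (m : ℕ) (R : Set (Fin m → Fin m → Prop)) (p : Fin m → E3 × ℝ) (u : E3), (∀ i, (p i).2 ≠ 0) → lam m R (fun i => ((p i).1 + u, (p i).2)) = lam m R p) → (∀ (m : ℕ) (R : Set (Fin m → Fin m → Prop)) (p : Fin m → E3 × ℝ) (κ : ℝ), (∀ i, (p i).2 ≠ 0) → 0 < κ → lam m R (fun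 i => (κ • (p i).1, κ * (p i).2)) = lam m R p) → (∀ (m : ℕ) (R : Set (Fin m → Fin m → Prop)) (p : Fin m → E3 × ℝ) (A : E3 ≃ₗᵢ[ℝ] E3), (∀ i, (p i).2 ≠ 0) → lam m R (fun i => (A (p i).1, (p i).2)) = lam m R p) → (∀ (m : ℕ) (R : Set (Fin m → Fin m → Prop)) (p : Fin m → E3 × ℝ), (∀ i, (p i).2 ≠ 0 ∧ ‖(p i).1‖ ≠ |(p i).2|) → lam m R (fun i => ginv (p i)) = lam m R p)

end Registered


/-! ### The crux's `let`-vocabulary as definitions (definitionally the `let` values) and the glue: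
### a dilation of the data is EXACTLY a change of mesh, so clause (D) follows from existence alone -/
noncomputable section Glue

open Literature.Probability.LatticeModels Literature.Probability.Percolation Literature.Barriers.CriticalPhenomena

/-- The crux's `mesh` (verbatim value): the lattice point `z` at mesh `δ`, i.e. `δ • z ∈ ℝ³`. -/
def bmesh (δ : ℝ) (z : Site 3) : EuclideanSpace ℝ (Fin 3) := WithLp.toLp 2 fun i : Fin 3 => δ * (z i : ℝ)

/-- The crux's `disc` (verbatim value): the mesh-`δ` discretisation of a continuum set. -/
def bdisc (δ : ℝ) (A : Set (EuclideanSpace ℝ (Fin 3))) : Set (Site 3) := {x | bmesh δ x ∈ A}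

/-- The crux's `gball` (verbatim value): the generalised ball with data `(c, r)` — the closed ball
for `r > 0`, the closed exterior of the open ball of radius `-r` otherwise. -/
def bgball (p : EuclideanSpace ℝ (Fin 3) × ℝ) : Set (EuclideanSpace ℝ (Fin 3)) :=
  if 0 < p.2 then Metric.closedBall p.1 p.2 else (Metric.ball p.1 (-p.2))ᶜ

/-- The crux's `Pr` with `μ`, `PrL` inlined (verbatim values): the thermodynamic-limit (`limUnder`
over wired critical FK-Ising boxes) probability that the open-path connection relation among the
lattice sets `K i` lies in `R`. -/
def bPr (m : ℕ) (K : Fin m → Set (Site 3)) (R : Set (Fin m → Fin m → Prop)) : ℝ :=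
  limUnder atTop (fun L : ℕ => (rcMeasure (boxGraph 3 L) (fkIsingParam (criticalBeta 3)) 2 (boxBoundary 3 L)).real
    {ω | (fun i j => ∃ x y : BoxV 3 L, x.1 ∈ K i ∧ y.1 ∈ K j ∧ (openGraph ω).Reachable x y) ∈ R})

/-- Change of mesh: `κ • (δ/κ) z = δ z`. [folklore] -/
theorem smul_bmesh_div {κ : ℝ} (hκ : κ ≠ 0) (δ : ℝ) (z : Site 3) :
    κ • bmesh (δ / κ) z = bmesh δ z := by
  simp only [bmesh, ← WithLp.toLp_smul]
  congr 1
  funext i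
  simp only [Pi.smul_apply, smul_eq_mul]
  rw [← mul_assoc, mul_div_assoc', mul_div_cancel_left₀ _ hκ]

/-- Distances to a dilated centre scale with the mesh: `dist (δz, κc) = κ · dist ((δ/κ)z, c)`.
[folklore] -/
theorem dist_bmesh_smul {κ : ℝ} (hκ : 0 < κ) (δ : ℝ) (z : Site 3) (c : EuclideanSpace ℝ (Fin 3)) :
    dist (bmesh δ z) (κ • c) = κ * dist (bmesh (δ / κ) z) c := by
  rw [← smul_bmesh_div hκ.ne' δ z, dist_smul₀, Real.norm_of_nonneg hκ.le]

/-- THE EXACT LATTICE IDENTITY: discretising the `κ`-dilated generalised ball at mesh `δ` gives the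
same lattice set as discretising the original one at mesh `δ/κ` (both signs of the radius).
[folklore] -/
theorem bdisc_bgball_smul {κ : ℝ} (hκ : 0 < κ) (δ : ℝ) (q : EuclideanSpace ℝ (Fin 3) × ℝ) :
    bdisc δ (bgball (κ • q.1, κ * q.2)) = bdisc (δ / κ) (bgball q) := by
  ext z
  simp only [bdisc, bgball, Set.mem_setOf_eq]
  by_cases h : 0 < q.2
  · have h' : 0 < κ * q.2 := mul_pos hκ h
    rw [if_pos h', if_pos h, Metric.mem_closedBall, Metric.mem_closedBall, dist_bmesh_smul hκ,
      mul_le_mul_iff_right₀ hκ]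
  · have h' : ¬ 0 < κ * q.2 := fun h' => h (pos_of_mul_pos_right h' hκ.le)
    rw [if_neg h', if_neg h, Set.mem_compl_iff, Set.mem_compl_iff, Metric.mem_ball, Metric.mem_ball,
      dist_bmesh_smul hκ, neg_mul_eq_mul_neg, mul_lt_mul_iff_right₀ hκ]

/-- `δ ↦ δ/κ` maps the right-neighbourhood filter of `0` to itself (`κ > 0`). [folklore] -/
theorem tendsto_div_const_nhdsGT {κ : ℝ} (hκ : 0 < κ) :
    Tendsto (fun δ : ℝ => δ / κ) (𝓝[>] (0 : ℝ)) (𝓝[>] (0 : ℝ)) := by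
  refine tendsto_nhdsWithin_of_tendsto_nhds_of_eventually_within _ ?_ ?_
  · have h0 : Tendsto (fun δ : ℝ => δ / κ) (𝓝 0) (𝓝 (0 / κ)) := tendsto_id.div_const κ
    rw [zero_div] at h0
    exact h0.mono_left nhdsWithin_le_nhds
  · filter_upwards [self_mem_nhdsWithin] with δ hδ
    exact div_pos hδ hκ

/-- DILATION INVARIANCE FROM EXISTENCE (the glue lemma): if the ball-connection functional `P` of the
mesh-`δ` discretisations has a full-filter limit `lam p` as `δ → 0⁺` at every nonzero-radius
configuration, then `lam` is invariant under every dilation `κ > 0` of the data — the dilated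
configuration at mesh `δ` IS the original configuration at mesh `δ/κ` (`bdisc_bgball_smul`), and
limits along `𝓝[>] 0` are unique.  `P` is arbitrary (for the crux: `K ↦ Pr m K R`). [folklore] -/
theorem dilation_of_scalingLimit {m : ℕ} (P : (Fin m → Set (Site 3)) → ℝ)
    (lam : (Fin m → EuclideanSpace ℝ (Fin 3) × ℝ) → ℝ)
    (hlim : ∀ p : Fin m → EuclideanSpace ℝ (Fin 3) × ℝ, (∀ i, (p i).2 ≠ 0) →
      Tendsto (fun δ => P (fun i => bdisc δ (bgball (p i)))) (𝓝[>] 0) (𝓝 (lam p)))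
    (p : Fin m → EuclideanSpace ℝ (Fin 3) × ℝ) (κ : ℝ) (hp : ∀ i, (p i).2 ≠ 0) (hκ : 0 < κ) :
    lam (fun i => (κ • (p i).1, κ * (p i).2)) = lam p := by
  have hpκ : ∀ i : Fin m, κ * (p i).2 ≠ 0 := fun i => mul_ne_zero hκ.ne' (hp i)
  have h1 : Tendsto (fun δ => P (fun i => bdisc (δ / κ) (bgball (p i)))) (𝓝[>] 0)
      (𝓝 (lam (fun i => (κ • (p i).1, κ * (p i).2)))) := by
    refine (hlim (fun i => (κ • (p i).1, κ * (p i).2)) hpκ).congr (fun δ => ?_)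
    show P (fun i => bdisc δ (bgball (κ • (p i).1, κ * (p i).2))) = _
    exact congrArg P (funext fun i => bdisc_bgball_smul hκ δ (p i))
  have h2 : Tendsto (fun δ => P (fun i => bdisc (δ / κ) (bgball (p i)))) (𝓝[>] 0) (𝓝 (lam p)) :=
    (hlim p hp).comp (tendsto_div_const_nhdsGT hκ)
  exact tendsto_nhds_unique h1 h2

end Glue

section PointGroup
open Literature.Probability.LatticeModels Literature.Probability.Percolation Literature.Barriers.CriticalPhenomena Literature.Analysis.FluidPDE

set_option linter.unusedVariables false in
/-- HYPEROCTAHEDRAL INVARIANCE FROM EXISTENCE (exact lattice symmetry, the provable part of stub 2c;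
proved by worker `rot_` and LANDED as Literature p149498 `RandomClusterPointGroupInvariance`:
`connRelLaw_scalingLimit_signedPermIsometry_eq`, with `rcMeasure_real_connRelLaw_box_signedPerm` =
invariance of every wired box law under the 48 signed coordinate permutations, Grimmett 2006
Thm 4.19(b) point-group half): any full-filter limit family `lam m R` of the ball-connection
probabilities is invariant under the linear isometries of `E3` induced by the point group of `ℤ³`
(`Literature.Analysis.FluidPDE.signedPermIsometry`).  Stated on the crux's `let`-vocabulary; not used by
`BallConnectivityMoebius_of` (stub 2c asserts all of `O(3)`), recorded here as the certified exact-symmetry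
content of the line. [folklore] -/
theorem hyperoctahedral_of_scalingLimit : open Literature.Probability.LatticeModels Literature.Probability.Percolation Literature.Barriers.CriticalPhenomena Filter Topology in let E3 := EuclideanSpace ℝ (Fin 3); let μ : (L : ℕ) → MeasureTheory.Measure (BondConfig (BoxV 3 L)) := fun L => rcMeasure (boxGraph 3 L) (fkIsingParam (criticalBeta 3)) 2 (boxBoundary 3 L); let PrL : (m : ℕ) → (Fin m → Set (Site 3)) → Set (Fin m → Fin m → Prop) → ℕ → ℝ := fun _ K R L => (μ L).real {ω | (fun i j => ∃ x y : BoxV 3 L, x.1 ∈ K i ∧ y.1 ∈ K j ∧ (openGraph ω).Reachable x y) ∈ R}; let Pr : (m : ℕ) → (Fin m → Set (Site 3)) → Set (Fin m → Fin m → Prop) → ℝ := fun m K R => limUnder atTop (PrL m K R); let mesh : ℝ → Site 3 → E3 := fun δ z => WithLp.toLp 2 fun i : Fin 3 => δ * (z i : ℝ); let disc : ℝ → Set E3 → Set (Site 3) := fun δ A => {x | mesh δ x ∈ A}; let gball : E3 × ℝ → Set E3 := fun p => if 0 < p.2 then Metric.closedBall p.1 p.2 else (Metric.ball p.1 (-p.2))ᶜ;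 ∀ lam : (m : ℕ) → Set (Fin m → Fin m → Prop) → (Fin m → E3 × ℝ) → ℝ, (∀ (m : ℕ) (R : Set (Fin m → Fin m → Prop)) (p : Fin m → E3 × ℝ), (∀ i, (p i).2 ≠ 0) → Tendsto (fun δ => Pr m (fun i => disc δ (gball (p i))) R) (𝓝[>] 0) (𝓝 (lam m R p))) → ∀ (m : ℕ) (R : Set (Fin m → Fin m → Prop)) (p : Fin m → E3 × ℝ) (π : Equiv.Perm (Fin 3)) (ε : Fin 3 → ℤˣ), (∀ i, (p i).2 ≠ 0) → lam m R (fun i => (signedPermIsometry π.symm ε (p i).1, (p i).2)) = lam m R p := by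
  intro E3 μ PrL Pr mesh disc gball lam hlim m R p π ε hp
  exact connRelLaw_scalingLimit_signedPermIsometry_eq (fkIsingParam_mem_Icc (criticalBeta_nonneg 3))
    two_pos R (lam m R) (hlim m R) p hp π ε

end PointGroup

/-- ASSEMBLY (kernel-checked, no sorry): the five stubs imply the crux, literally the route decl
`Summit.CriticalPhenomena.Ising3DConformalLimit.Theses.ArmDressing.BallConnectivityMoebius`.
Stub 1 (read through the definitional vocabulary `bPr/bdisc/bgball`) gives, by choice, a limit
family `lam m R` with continuity and full-filter convergence; the glue lemma
`dilation_of_scalingLimit` PROVES its dilation invariance (D); stub 2b applied to stub 2a gives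
translations (T), stub 2c gives `O(3)` (O); stub 3 turns (T)+(D)+(O)+continuity+convergence into
inversion invariance (I); the six clauses are reassembled for each `m, R`. -/
theorem BallConnectivityMoebius_of (h1 : Registered.stub_ballLawsExist)
    (h2a : Registered.stub_latticeTranslation) (h2b : Registered.stub_translationInvariance)
    (h2c : Registered.stub_rotationInvariance) (h3 : Registered.stub_inversionInvariance) :
    Summit.CriticalPhenomena.Ising3DConformalLimit.Theses.ArmDressing.BallConnectivityMoebius := by
  have h1' : ∀ (m : ℕ) (R : Set (Fin m → Fin m → Prop)),
      ∃ lam : (Fin m → EuclideanSpace ℝ (Fin 3) × ℝ) → ℝ,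
        ContinuousOn lam {p | ∀ i, (p i).2 ≠ 0} ∧
        ∀ p : Fin m → EuclideanSpace ℝ (Fin 3) × ℝ, (∀ i, (p i).2 ≠ 0) →
          Tendsto (fun δ => bPr m (fun i => bdisc δ (bgball (p i))) R) (𝓝[>] 0) (𝓝 (lam p)) := h1
  choose lam hcont hlim using h1'
  have hdil : ∀ (m : ℕ) (R : Set (Fin m → Fin m → Prop)) (p : Fin m → EuclideanSpace ℝ (Fin 3) × ℝ)
      (κ : ℝ), (∀ i, (p i).2 ≠ 0) → 0 < κ → lam m R (fun i => (κ • (p i).1, κ * (p i).2)) = lam m R p :=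
    fun m R p κ hp hκ => dilation_of_scalingLimit (fun K => bPr m K R) (lam m R) (hlim m R) p κ hp hκ
  have htr := h2b h2a lam hcont hlim
  have hrot := h2c lam hcont hlim
  have hinv := h3 lam hcont hlim htr hdil hrot
  intro m R
  exact ⟨lam m R, hcont m R, hlim m R, htr m R, hdil m R, hrot m R, hinv m R⟩

/-- The same assembly with the registered stubs plugged in (consistency check of the aliases;
sorries only inside `stub_*`). -/
theorem BallConnectivityMoebius_of_stubs :
    Summit.CriticalPhenomena.Ising3DConformalLimit.Theses.ArmDressing.BallConnectivityMoebius :=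
  BallConnectivityMoebius_of stub_ballLawsExist stub_latticeTranslation stub_translationInvariance
    stub_rotationInvariance stub_inversionInvariance

end Summit.CriticalPhenomena.Ising3DConformalLimit.Cruxes.BallConnectivityMoebius.Birth
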